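import Summits.Ventures.HodgeKum4.Theorems.KummerFixedLocusDefs
import Summits.Ventures.HodgeKum4.FixedLocus
import Summits.Ventures.HodgeKum4.Theorems.KummerFixedLocusGSignatureBookkeeping
import Literature.AlgebraicGeometry.HodgeTheory.VanishingCohomologyNontrivialProofs
import Literature.AlgebraicTopology.SingularHomology.HomologyRingChange
import HarnessLib

/-!
# I2′ skeleton: `Sign(ι, X) = σ(X) − 624 = 6` for `Kum⁴`-type, KERNEL modulo named-fact hypotheses
# (cell `hodge-kum4`, seat p2; carriers of HOME/p2/I2-CARRIERS.md; `Γ(X) = autFixingH2H3 X` from the cell's `Statement.lean`)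

HONEST FRAMING.  No case of the Hodge conjecture and no intersection number is ASSERTED here.  This
file fixes the REAL carriers on which the print inputs A0–A5 of the `G`-signature route
(G2-AUDIT §A5′) are to be vendored, and PROVES the bookkeeping
`A0 ∧ A3 ∧ A4 ∧ A5 ∧ F_Γℝ ⇒ Sign(ι, X) = 6` from the kernel lemma
`Signature.sig_twist_eq_sig_sub_finrank`.  The remaining step `[W_X]² = Sign(ι, X)` is the
`G`-signature theorem (A1, Hirzebruch 1969 (6)) with Floccari's Lemma 4.2 (A2), not typed here.

Carriers: `realBetti X k = Hᵏ(X(ℂ); ℝ)` (`singularCohomology ℝ ℝ`), pull-backs `realBetti.map`,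
the real fundamental class `[X(ℂ)] ⊗ 1` of a `ℤ`-orientation `μ`
(`singularHomology.coeffChange`, as in `Topology/FourManifolds/IntersectionFormRealPositive`), the
real cup pairing `realPairing X μ (y, y') = ⟨y ∪ y', [X(ℂ)] ⊗ 1⟩`, the representation
`middleRepReal X` of `Γ(X) = autFixingH2H3 X` on `H⁸(X(ℂ); ℝ)` by `g ↦ (g⁻¹)^*`, and
`sig B = σ₊ − σ₋` of the quadratic form of `B` (Mathlib `QuadraticForm.sigPos/sigNeg`).

Hypotheses of `kum4_gSignature_eq_six` and their sources: `hcomm` = the tree's named fact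
`cupProduct_gradedComm` (Hatcher Thm 3.11); `hμ` (A0) = holomorphic automorphisms preserve the
complex fundamental class; `hΓ` (F_Γℝ) = `|Γ| = 625`, `dim_ℝ 𝒦ℝ = 624` (Foster 2024 Prop 87;
BNWS/HT/Oguiso); `hιΓ` = `ι g ι = g⁻¹` on `Γ` (`Aut₀ = Γ ⋊ ⟨ι⟩`, BNWS 2011); `hpos` (A4) =
Hodge–Riemann on the `Γ`-non-invariant middle classes; `hfix` (A5) = `ι^* = +1` on `H⁸(X)^Γ`
(L1 + Oguiso); `hσ` (A3) = Hodge index + Göttsche–Soergel, `σ(X) = 630`.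
-/

noncomputable section

open CategoryTheory Representation QuadraticMap QuadraticForm
open Literature.AlgebraicGeometry Literature.AlgebraicGeometry.HodgeTheory
  Literature.AlgebraicGeometry.Hyperkaehler Literature.AlgebraicTopology.SingularHomology

namespace Summit.Ventures.HodgeKum4


/-! ### The bookkeeping theorem -/

/-- `H⁸(X(ℂ); ℝ)` is finite-dimensional for smooth projective `X`. -/
theorem finite_realBetti {X : Motives.SchemeOver ℂ} {n : ℕ} (hX : Motives.IsSmoothProjective n X)
    (k : ℕ) : Module.Finite ℝ (realBetti X k) := by
  letI := hX.chartedSpace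
  haveI := Motives.ComplexPoints.compactSpace_of_isSmoothProjective hX
  haveI := Motives.ComplexPoints.t2Space_of_isSmoothProjective hX
  exact finite_singularCohomology_of_compact_chartedSpace ℝ ℝ (d := 2 * n) k

/-- **I2′ bookkeeping, KERNEL modulo named-fact hypotheses: `Sign(ι, X) = 630 − 624 = 6`.**
For `X` smooth projective of `Kum⁴`-type, `μ` a `ℤ`-orientation of `X(ℂ)`, `ι ∈ Aut X` an
involution inverting `Γ(X)` by conjugation; assuming graded commutativity of `⌣` (tree named fact),
that `ι` and `Γ(X)` preserve `[X(ℂ)] ⊗ 1` (A0), `|Γ(X)| = 625` and `dim_ℝ 𝒦ℝ = 624` (F_Γℝ),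
Hodge–Riemann positivity of the real cup pairing on `𝒦ℝ` (A4), `ι^* = +1` on `H⁸(X(ℂ); ℝ)^Γ`
(A5), and `σ(X) = 630` (A3): the signature of the twisted form `(y, y') ↦ ⟨y ∪ ι^*y', [X]⟩` is `6`. -/
theorem kum4_gSignature_eq_six {X : Motives.SchemeOver ℂ} (hX : Motives.IsSmoothProjective 8 X)
    (μ : HomologicalOrientation ℤ (Motives.ComplexPoints X) 16) (ι : Aut X) (hι2 : ι * ι = 1)
    (hιΓ : ∀ g : Aut X, g ∈ autFixingH2H3 X → ι * g * ι = g⁻¹)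
    (hcomm : cupProduct_gradedComm ℝ (Motives.ComplexPoints X))
    (hμΓ : ∀ g : Aut X, g ∈ autFixingH2H3 X →
      singularHomology.map ℝ ℝ (Motives.AlgPoints.mapContinuous (L := ℂ) g.hom) 16
        (realFundamentalClass X μ) = realFundamentalClass X μ)
    (hΓ : Nat.card (autFixingH2H3 X) = 625 ∧
      Module.finrank ℝ (Coinvariants.ker (middleRepReal X)) = 624)
    (hpos : ∀ x ∈ Coinvariants.ker (middleRepReal X), x ≠ 0 → 0 < realPairing X μ x x)
    (hfix : ∀ x ∈ (middleRepReal X).invariants, (realBetti.map ι.hom 8).hom x = x)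
    (hσ : sig (realPairing X μ) = 630) :
    sig ((realPairing X μ).compl₂ (realBetti.map ι.hom 8).hom) = 6 := by
  obtain ⟨hcard, hdim⟩ := hΓ
  haveI : Finite (autFixingH2H3 X) := Nat.finite_of_card_ne_zero (by rw [hcard]; norm_num)
  letI : Fintype (autFixingH2H3 X) := Fintype.ofFinite _
  haveI : Module.Finite ℝ (realBetti X 8) := finite_realBetti hX 8
  have hodd : (Nat.card (autFixingH2H3 X)).Coprime 2 := by rw [hcard]; decide
  set B := realPairing X μ with hBdef
  set ιr : realBetti X 8 →ₗ[ℝ] realBetti X 8 := (realBetti.map ι.hom 8).hom with hιr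
  -- symmetry of the real cup pairing in even degree (graded commutativity)
  have hBsymm : ∀ x y, B x y = B y x := by
    intro x y
    rw [hBdef, realPairing_apply, realPairing_apply, hcomm rfl rfl x y]
    norm_num
  -- invariance of the pairing under an automorphism preserving the fundamental class
  have hBmap : ∀ g : Aut X, singularHomology.map ℝ ℝ (Motives.AlgPoints.mapContinuous (L := ℂ) g.hom)
      16 (realFundamentalClass X μ) = realFundamentalClass X μ →
      ∀ x y, B ((realBetti.map g.hom 8).hom x) ((realBetti.map g.hom 8).hom y) = B x y := by
    intro g hg x y
    rw [hBdef, realPairing_apply, realPairing_apply]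
    change kroneckerPairing ℝ ℝ _ 16 (cupProduct rfl
      (singularCohomology.map ℝ ℝ _ 8 x) (singularCohomology.map ℝ ℝ _ 8 y)) _ = _
    rw [← cupProduct_map, kroneckerPairing_map, hg]
  have hBinv : ∀ (g : autFixingH2H3 X) (x y : realBetti X 8),
      B (middleRepReal X g x) (middleRepReal X g y) = B x y := by
    intro g x y
    rw [middleRepReal_apply, middleRepReal_apply]
    exact hBmap _ (hμΓ _ (g⁻¹).2) x y
  -- ι^* is an involution
  have hιr2 : ιr ∘ₗ ιr = LinearMap.id := by
    have h1 : realBetti.map (ι * ι).hom 8 = 𝟙 _ := by rw [hι2]; exact realBetti.map_id 8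
    have h2 : realBetti.map (ι * ι).hom 8 = realBetti.map ι.hom 8 ≫ realBetti.map ι.hom 8 :=
      realBetti.map_comp ι.hom ι.hom 8
    rw [h2] at h1
    have h3 := congrArg ModuleCat.Hom.hom h1
    exact h3
  -- ι inverts Γ: ι^* ∘ (g⁻¹)^* = g^* ∘ ι^* = ρ(g⁻¹) ∘ ι^*
  have hιρ : ∀ g : autFixingH2H3 X, ιr ∘ₗ middleRepReal X g = middleRepReal X g⁻¹ ∘ₗ ιr := by
    intro g
    have hrel : (g⁻¹).val * ι = ι * g.val := by
      have h := hιΓ g.val g.2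
      -- ι * g * ι = g⁻¹  ⇒  g⁻¹ * ι = ι * g * ι * ι = ι * g
      calc (g⁻¹).val * ι = ι * g.val * ι * ι := by rw [h]; rfl
        _ = ι * g.val := by rw [mul_assoc, hι2, mul_one]
    have h1 : realBetti.map ((g⁻¹).val * ι).hom 8 = realBetti.map (ι * g.val).hom 8 := by rw [hrel]
    rw [show ((g⁻¹).val * ι).hom = ι.hom ≫ (g⁻¹).val.hom from rfl,
      show (ι * g.val).hom = g.val.hom ≫ ι.hom from rfl, realBetti.map_comp,
      realBetti.map_comp] at h1
    have h2 := congrArg ModuleCat.Hom.hom h1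
    -- h2 : ((g⁻¹)^* ≫ ι^*).hom = (ι^* ≫ g^*).hom, i.e. ιr ∘ (g⁻¹)^* = g^* ∘ ιr
    change ιr ∘ₗ (realBetti.map (g⁻¹).val.hom 8).hom =
      (realBetti.map ((g⁻¹)⁻¹).val.hom 8).hom ∘ₗ ιr
    rw [inv_inv]
    exact h2
  -- apply the bookkeeping lemma
  have key := Signature.sig_twist_eq_sig_sub_finrank hodd (middleRepReal X) B hBsymm hBinv ιr hιr2
    hιρ hfix hpos
  unfold sig at hσ ⊢
  rw [key, hσ, hdim]
  norm_num


/-- **I2′ bookkeeping in the orientation-free `ε`-form of the tree's Hodge index / Hodge–Riemann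
record** (`HodgeTheory.Voisin2002_hodgeIndex_hodgeRiemann_middle`: `σ(B_μ) = ε·630`, `0 < ε B_μ(x,x)`
on `𝒦ℝ ∖ 0`, one sign `ε = ±1` = whether `μ` is the complex orientation): `Sign_μ(ι, X) = 6 ε`.
For `ε = 1` this is `kum4_gSignature_eq_six`; for `ε = −1` apply it to `−B` (`σ(−B) = −σ(B)`,
`(−B)_ι = −B_ι`, `Signature.sig_neg_bilin`). -/
theorem kum4_gSignature_eq_six_eps {X : Motives.SchemeOver ℂ} (hX : Motives.IsSmoothProjective 8 X)
    (μ : HomologicalOrientation ℤ (Motives.ComplexPoints X) 16) (ι : Aut X) (hι2 : ι * ι = 1)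
    (hιΓ : ∀ g : Aut X, g ∈ autFixingH2H3 X → ι * g * ι = g⁻¹)
    (hcomm : cupProduct_gradedComm ℝ (Motives.ComplexPoints X))
    (hμΓ : ∀ g : Aut X, g ∈ autFixingH2H3 X →
      singularHomology.map ℝ ℝ (Motives.AlgPoints.mapContinuous (L := ℂ) g.hom) 16
        (realFundamentalClass X μ) = realFundamentalClass X μ)
    (hΓ : Nat.card (autFixingH2H3 X) = 625 ∧
      Module.finrank ℝ (Coinvariants.ker (middleRepReal X)) = 624)
    (ε : ℤ) (hε : ε = 1 ∨ ε = -1)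
    (hpos : ∀ x ∈ Coinvariants.ker (middleRepReal X), x ≠ 0 → 0 < (ε : ℝ) * realPairing X μ x x)
    (hfix : ∀ x ∈ (middleRepReal X).invariants, (realBetti.map ι.hom 8).hom x = x)
    (hσ : sig (realPairing X μ) = ε * 630) :
    sig ((realPairing X μ).compl₂ (realBetti.map ι.hom 8).hom) = ε * 6 := by
  rcases hε with rfl | rfl
  · simp only [Int.cast_one, one_mul] at hpos hσ ⊢
    exact kum4_gSignature_eq_six hX μ ι hι2 hιΓ hcomm hμΓ hΓ hpos hfix hσ
  · -- ε = -1: run the bookkeeping for `-B`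
    obtain ⟨hcard, hdim⟩ := hΓ
    haveI : Finite (autFixingH2H3 X) := Nat.finite_of_card_ne_zero (by rw [hcard]; norm_num)
    letI : Fintype (autFixingH2H3 X) := Fintype.ofFinite _
    haveI : Module.Finite ℝ (realBetti X 8) := finite_realBetti hX 8
    have hodd : (Nat.card (autFixingH2H3 X)).Coprime 2 := by rw [hcard]; decide
    set B := realPairing X μ with hBdef
    set ιr : realBetti X 8 →ₗ[ℝ] realBetti X 8 := (realBetti.map ι.hom 8).hom with hιr
    have hBsymm : ∀ x y, B x y = B y x := by
      intro x y
      rw [hBdef, realPairing_apply, realPairing_apply, hcomm rfl rfl x y]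
      norm_num
    have hBmap : ∀ g : Aut X, singularHomology.map ℝ ℝ (Motives.AlgPoints.mapContinuous (L := ℂ) g.hom)
        16 (realFundamentalClass X μ) = realFundamentalClass X μ →
        ∀ x y, B ((realBetti.map g.hom 8).hom x) ((realBetti.map g.hom 8).hom y) = B x y := by
      intro g hg x y
      rw [hBdef, realPairing_apply, realPairing_apply]
      change kroneckerPairing ℝ ℝ _ 16 (cupProduct rfl
        (singularCohomology.map ℝ ℝ _ 8 x) (singularCohomology.map ℝ ℝ _ 8 y)) _ = _
      rw [← cupProduct_map, kroneckerPairing_map, hg]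
    have hBinv : ∀ (g : autFixingH2H3 X) (x y : realBetti X 8),
        B (middleRepReal X g x) (middleRepReal X g y) = B x y := by
      intro g x y
      rw [middleRepReal_apply, middleRepReal_apply]
      exact hBmap _ (hμΓ _ (g⁻¹).2) x y
    have hιr2 : ιr ∘ₗ ιr = LinearMap.id := by
      have h1 : realBetti.map (ι * ι).hom 8 = 𝟙 _ := by rw [hι2]; exact realBetti.map_id 8
      have h2 : realBetti.map (ι * ι).hom 8 = realBetti.map ι.hom 8 ≫ realBetti.map ι.hom 8 :=
        realBetti.map_comp ι.hom ι.hom 8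
      rw [h2] at h1
      exact congrArg ModuleCat.Hom.hom h1
    have hιρ : ∀ g : autFixingH2H3 X, ιr ∘ₗ middleRepReal X g = middleRepReal X g⁻¹ ∘ₗ ιr := by
      intro g
      have hrel : (g⁻¹).val * ι = ι * g.val := by
        have h := hιΓ g.val g.2
        calc (g⁻¹).val * ι = ι * g.val * ι * ι := by rw [h]; rfl
          _ = ι * g.val := by rw [mul_assoc, hι2, mul_one]
      have h1 : realBetti.map ((g⁻¹).val * ι).hom 8 = realBetti.map (ι * g.val).hom 8 := by rw [hrel]
      rw [show ((g⁻¹).val * ι).hom = ι.hom ≫ (g⁻¹).val.hom from rfl,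
        show (ι * g.val).hom = g.val.hom ≫ ι.hom from rfl, realBetti.map_comp,
        realBetti.map_comp] at h1
      have h2 := congrArg ModuleCat.Hom.hom h1
      change ιr ∘ₗ (realBetti.map (g⁻¹).val.hom 8).hom =
        (realBetti.map ((g⁻¹)⁻¹).val.hom 8).hom ∘ₗ ιr
      rw [inv_inv]
      exact h2
    -- the bookkeeping lemma for `-B`
    have hnegsymm : ∀ x y, (-B) x y = (-B) y x := by
      intro x y; simp only [LinearMap.neg_apply, hBsymm x y]
    have hneginv : ∀ (g : autFixingH2H3 X) (x y : realBetti X 8),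
        (-B) (middleRepReal X g x) (middleRepReal X g y) = (-B) x y := by
      intro g x y; simp only [LinearMap.neg_apply, hBinv g x y]
    have hnegpos : ∀ x ∈ Coinvariants.ker (middleRepReal X), x ≠ 0 → 0 < (-B) x x := by
      intro x hx hx0
      have h := hpos x hx hx0
      simp only [Int.reduceNeg, Int.cast_neg, Int.cast_one, neg_mul, one_mul] at h
      simpa only [LinearMap.neg_apply] using h
    have key := Signature.sig_twist_eq_sig_sub_finrank hodd (middleRepReal X) (-B) hnegsymm hneginv
      ιr hιr2 hιρ hfix hnegpos
    rw [Signature.neg_compl₂, Signature.sig_neg_bilin, Signature.sig_neg_bilin, hdim] at key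
    unfold sig at hσ ⊢
    push_cast at hσ key ⊢
    linarith


/-- **I2′ bookkeeping, weakest print form**: with only `dim_ℝ 𝒦ℝ ≤ 624` (Foster's regular
representation, the landed `Foster2024_translationAction_kum4Type` clause (i′)) and the `ε`-form
HI/HR inputs, `Sign_μ(ι, X) = ε · (630 − dim 𝒦ℝ)`; in particular `|Sign_μ(ι, X)| ≥ 6`. -/
theorem kum4_gSignature_eq_eps {X : Motives.SchemeOver ℂ} (hX : Motives.IsSmoothProjective 8 X)
    (μ : HomologicalOrientation ℤ (Motives.ComplexPoints X) 16) (ι : Aut X) (hι2 : ι * ι = 1)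
    (hιΓ : ∀ g : Aut X, g ∈ autFixingH2H3 X → ι * g * ι = g⁻¹)
    (hcomm : cupProduct_gradedComm ℝ (Motives.ComplexPoints X))
    (hμΓ : ∀ g : Aut X, g ∈ autFixingH2H3 X →
      singularHomology.map ℝ ℝ (Motives.AlgPoints.mapContinuous (L := ℂ) g.hom) 16
        (realFundamentalClass X μ) = realFundamentalClass X μ)
    (hcard : Nat.card (autFixingH2H3 X) = 625)
    (ε : ℤ) (hε : ε = 1 ∨ ε = -1)
    (hpos : ∀ x ∈ Coinvariants.ker (middleRepReal X), x ≠ 0 → 0 < (ε : ℝ) * realPairing X μ x x)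
    (hfix : ∀ x ∈ (middleRepReal X).invariants, (realBetti.map ι.hom 8).hom x = x)
    (hσ : sig (realPairing X μ) = ε * 630) :
    sig ((realPairing X μ).compl₂ (realBetti.map ι.hom 8).hom) =
      ε * (630 - (Module.finrank ℝ (Coinvariants.ker (middleRepReal X)) : ℤ)) := by
  haveI : Finite (autFixingH2H3 X) := Nat.finite_of_card_ne_zero (by rw [hcard]; norm_num)
  letI : Fintype (autFixingH2H3 X) := Fintype.ofFinite _
  haveI : Module.Finite ℝ (realBetti X 8) := finite_realBetti hX 8
  have hodd : (Nat.card (autFixingH2H3 X)).Coprime 2 := by rw [hcard]; decide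
  set B := realPairing X μ with hBdef
  set ιr : realBetti X 8 →ₗ[ℝ] realBetti X 8 := (realBetti.map ι.hom 8).hom with hιr
  have hBsymm : ∀ x y, B x y = B y x := by
    intro x y
    rw [hBdef, realPairing_apply, realPairing_apply, hcomm rfl rfl x y]
    norm_num
  have hBmap : ∀ g : Aut X, singularHomology.map ℝ ℝ (Motives.AlgPoints.mapContinuous (L := ℂ) g.hom)
      16 (realFundamentalClass X μ) = realFundamentalClass X μ →
      ∀ x y, B ((realBetti.map g.hom 8).hom x) ((realBetti.map g.hom 8).hom y) = B x y := by
    intro g hg x y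
    rw [hBdef, realPairing_apply, realPairing_apply]
    change kroneckerPairing ℝ ℝ _ 16 (cupProduct rfl
      (singularCohomology.map ℝ ℝ _ 8 x) (singularCohomology.map ℝ ℝ _ 8 y)) _ = _
    rw [← cupProduct_map, kroneckerPairing_map, hg]
  have hBinv : ∀ (g : autFixingH2H3 X) (x y : realBetti X 8),
      B (middleRepReal X g x) (middleRepReal X g y) = B x y := by
    intro g x y
    rw [middleRepReal_apply, middleRepReal_apply]
    exact hBmap _ (hμΓ _ (g⁻¹).2) x y
  have hιr2 : ιr ∘ₗ ιr = LinearMap.id := by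
    have h1 : realBetti.map (ι * ι).hom 8 = 𝟙 _ := by rw [hι2]; exact realBetti.map_id 8
    have h2 : realBetti.map (ι * ι).hom 8 = realBetti.map ι.hom 8 ≫ realBetti.map ι.hom 8 :=
      realBetti.map_comp ι.hom ι.hom 8
    rw [h2] at h1
    exact congrArg ModuleCat.Hom.hom h1
  have hιρ : ∀ g : autFixingH2H3 X, ιr ∘ₗ middleRepReal X g = middleRepReal X g⁻¹ ∘ₗ ιr := by
    intro g
    have hrel : (g⁻¹).val * ι = ι * g.val := by
      have h := hιΓ g.val g.2
      calc (g⁻¹).val * ι = ι * g.val * ι * ι := by rw [h]; rfl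
        _ = ι * g.val := by rw [mul_assoc, hι2, mul_one]
    have h1 : realBetti.map ((g⁻¹).val * ι).hom 8 = realBetti.map (ι * g.val).hom 8 := by rw [hrel]
    rw [show ((g⁻¹).val * ι).hom = ι.hom ≫ (g⁻¹).val.hom from rfl,
      show (ι * g.val).hom = g.val.hom ≫ ι.hom from rfl, realBetti.map_comp,
      realBetti.map_comp] at h1
    have h2 := congrArg ModuleCat.Hom.hom h1
    change ιr ∘ₗ (realBetti.map (g⁻¹).val.hom 8).hom =
      (realBetti.map ((g⁻¹)⁻¹).val.hom 8).hom ∘ₗ ιr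
    rw [inv_inv]
    exact h2
  rcases hε with rfl | rfl
  · have hpos1 : ∀ x ∈ Coinvariants.ker (middleRepReal X), x ≠ 0 → 0 < B x x := by
      intro x hx hx0; simpa using hpos x hx hx0
    have key := Signature.sig_twist_eq_sig_sub_finrank hodd (middleRepReal X) B hBsymm hBinv ιr hιr2
      hιρ hfix hpos1
    unfold sig at hσ ⊢
    push_cast at hσ key ⊢
    linarith
  · have hnegsymm : ∀ x y, (-B) x y = (-B) y x := by
      intro x y; simp only [LinearMap.neg_apply, hBsymm x y]
    have hneginv : ∀ (g : autFixingH2H3 X) (x y : realBetti X 8),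
        (-B) (middleRepReal X g x) (middleRepReal X g y) = (-B) x y := by
      intro g x y; simp only [LinearMap.neg_apply, hBinv g x y]
    have hnegpos : ∀ x ∈ Coinvariants.ker (middleRepReal X), x ≠ 0 → 0 < (-B) x x := by
      intro x hx hx0
      have h := hpos x hx hx0
      simp only [Int.reduceNeg, Int.cast_neg, Int.cast_one, neg_mul, one_mul] at h
      simpa only [LinearMap.neg_apply] using h
    have key := Signature.sig_twist_eq_sig_sub_finrank hodd (middleRepReal X) (-B) hnegsymm hneginv
      ιr hιr2 hιρ hfix hnegpos
    rw [Signature.neg_compl₂, Signature.sig_neg_bilin, Signature.sig_neg_bilin] at key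
    unfold sig at hσ ⊢
    push_cast at hσ key ⊢
    linarith

/-- **Corollary: `|Sign_μ(ι, X)| ≥ 6` under `dim_ℝ 𝒦ℝ ≤ 624`** — so `Sign_μ(ι, X) ≠ ±1`, which is
all that the orbit-span input I consumes (`[W_X]² ≠ [W_X]·[g W_X] = ±1`). -/
theorem six_le_abs_kum4_gSignature {X : Motives.SchemeOver ℂ} (hX : Motives.IsSmoothProjective 8 X)
    (μ : HomologicalOrientation ℤ (Motives.ComplexPoints X) 16) (ι : Aut X) (hι2 : ι * ι = 1)
    (hιΓ : ∀ g : Aut X, g ∈ autFixingH2H3 X → ι * g * ι = g⁻¹)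
    (hcomm : cupProduct_gradedComm ℝ (Motives.ComplexPoints X))
    (hμΓ : ∀ g : Aut X, g ∈ autFixingH2H3 X →
      singularHomology.map ℝ ℝ (Motives.AlgPoints.mapContinuous (L := ℂ) g.hom) 16
        (realFundamentalClass X μ) = realFundamentalClass X μ)
    (hcard : Nat.card (autFixingH2H3 X) = 625)
    (hdim : Module.finrank ℝ (Coinvariants.ker (middleRepReal X)) ≤ 624)
    (ε : ℤ) (hε : ε = 1 ∨ ε = -1)
    (hpos : ∀ x ∈ Coinvariants.ker (middleRepReal X), x ≠ 0 → 0 < (ε : ℝ) * realPairing X μ x x)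
    (hfix : ∀ x ∈ (middleRepReal X).invariants, (realBetti.map ι.hom 8).hom x = x)
    (hσ : sig (realPairing X μ) = ε * 630) :
    6 ≤ |sig ((realPairing X μ).compl₂ (realBetti.map ι.hom 8).hom)| := by
  rw [kum4_gSignature_eq_eps hX μ ι hι2 hιΓ hcomm hμΓ hcard ε hε hpos hfix hσ, abs_mul]
  have hd : (Module.finrank ℝ (Coinvariants.ker (middleRepReal X)) : ℤ) ≤ 624 := by exact_mod_cast hdim
  rcases hε with rfl | rfl
  · rw [abs_one, one_mul]
    rw [abs_of_nonneg (by omega)]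
    omega
  · rw [abs_neg, abs_one, one_mul, abs_of_nonneg (by omega)]
    omega

end Summit.Ventures.HodgeKum4

end
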